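import Literature.IUT.HodgeArakelov.MonoThetaProjectiveBridgeEtThAtModelTate
import Literature.AnabelianGeometry.EtaleTheta.Discharge.Sec2RigidRowsAtModelTateInr
import HarnessLib

/-!
# [IUTchII] Prop. 1.5 (i)′ — the C-R33 «RE-CLOSE» sites of the closers `prop15_i'_of_cyclotomeTower` / `prop15_i'_etaleLevels`
# AT THE [EtTh] STAGE-2 MODELS: temp-slimness, openness of `aug` AND the Cor. 2.18 (iv) FIBRE clause (F-0638) are THEOREMS
# there; the residual is the Cor. 2.18 (iv) SURJECTIVITY instances (F-0639) alone (proof-only; D-0079 R-C / K-L6)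

S. Mochizuki, *Inter-universal Teichmüller theory II*, kurims manuscript (Dec. 2020), §1 Prop. 1.5 (i) p. 29
[claim: Mochizuki2012, status: disputed] (IUTchII §1 Prop 1.5 (i), kurims p.29); S. Mochizuki, *The étale theta function …*,
Publ. RIMS **45** (2009) [EtTh], §1 p. 12, Prop. 1.5 (iii) p. 23, Prop. 2.14 (i) p. 49, Cor. 2.18 (iv) pp. 61–63, Cor. 2.19 (ii)
p. 64 (PRIMS PDF pages) [cite: MochizukiEtTh2009, Cor 2.18 (iv) p.61].  Cell `abc-iut`, seat abc-iut-L6-t1 (gen 6; typer of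
record of [IUTchII] §1–§2), D-0079 sub-cell R-C/L-K, plan ruling C-R33 («a cone node whose closing theorem binds a hypothesis
headed by a FACT row of class refuted-closure is re-closed against the SURVIVING instance form»), abc-iut-c312-2's
`CONE-K4-RECLOSE.tsv` v3 row `IUTchII:Prop1.5(i)` (refuted-closure heads F-0638 `ThetaEnvData.Cor218_iv_fibre` / F-0639
`ThetaEnvData.Cor218_iv_surjective`, bound level-wise by abc-iut-w4-d024 / w4-d030 / L2-t10's closers
`EtaleLevels.prop15_i'_of_cyclotomeTower`, `prop15_i'_etaleLevels`); abc-iut-L6-lead §F v1.19bg (7) GO «L6-t1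
K4-L6-INSTANCES-IUTchII-S12» (+ at most one sibling file).  PROOF-ONLY: no definition, no instance, no new named fact; every
input consumed BY NAME; nothing of another seat edited or restated (the node's Prop. 1.5 (iii) sites are abc-iut-w5-d162's
`EtaleThetaDataRootLiftConjAtModelChi`, p462805 — not repeated here).

WHAT THIS FILE RECORDS (kernel facts about OUR typed closers at OUR semi-synthetic carriers).  At the stage-2 model family
`D := ThetaSetting.modelχq p i j hj` (abc-iut-L2-t5; every prime `p`, every `i`, every even `j`) the binders `hslimX`
(`isSlimGroup_PiTpχq`), `haugOpen` (`isOpenMap_aug_modelχq`) AND the level-wise FIBRE clause `hfibre` are THEOREMS — `hfibre` by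
abc-iut-f-150's `thetaEnvData_cor218_iv_fibre_of_origin` (⟸ abc-iut-L2-t8 `rigidData_cor218_iv_fibre_of_origin` ⟸ [EtTh] Prop.
2.14 (i) at an `IsEtThOrigin` setting, abc-iut-L2-t10 `cor218_iv_fibre_of_prop214_i`) over `ThetaSetting.modelχq_isEtThOrigin`,
`hYcl_modelχq` — so that [IUTchII] Prop. 1.5 (i)′ holds there, for EVERY étale-theta datum `E`, `X̲̲`-choice `C`, cyclotome
tower `τ` (resp. compatible family `mods`) and root cocycle `f`, modulo {[EtTh] Prop. 1.5 (iii) `h15`, the cusp labels `L`,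
the F-0639 level instances `hsurj`} (`prop15_i'_of_cyclotomeTower_modelχq_of_cor218_iv_surjective`,
`prop15_i'_etaleLevels_modelχq_of_cor218_iv_surjective`); and at the `inr`-section datum OF RECORD of the Tate instance
(abc-iut-w5-d171 `etaleThetaDataχqInr`, where Prop. 1.5 (iii) is abc-iut-L2-t6's theorem `prop15iii_etaleThetaDataχqInr`)
modulo {`L`, `hsurj`} ONLY (`prop15_i'_of_cyclotomeTower_modelTate_inr_of_cor218_iv_surjective`,
`prop15_i'_etaleLevels_modelTate_inr_of_cor218_iv_surjective`) — the alternative residual to the {Cor. 2.18 (i) at the chain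
levels (F-0620), `ThetaEnvTower.Cor219_iii` (F-0650)} list of abc-iut-w4-d038's `prop15_i'_of_cyclotomeTower_modelTate` (p454451),
matching abc-iut-w5-d233's `transitionsAreIsos_modelSystem_modelTate_of_cor218_iv_surjective` (p456075) for Prop. 1.5 (ii).

R-C READING (honest): of the node's two refuted-closure rows, F-0638 is DISCHARGED at a genuine (non-toy) carrier; F-0639
(= [EtTh] Cor. 2.18 (iv) surjectivity at the levels, equivalently {F-0620, F-0650} by abc-iut-f-150's
`thetaEnvData_cor218_iv_surjective_modAll`) is NOT a theorem at any carrier of the tree today — its closed producers need a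
trivial base group `G_K = 1` (abc-iut-f-151 `cor218_iv_surjective_of_stable`) or the level-3 toy; F-0620 at the Tate model is
abc-iut-L6-d6's row «COR218I-AT-MODELTATE» in flight.  That row is the [EtTh] §2 rigidity content and stays a NAMED binder
here.  `modelχq` is a SEMI-SYNTHETIC model of the typed [EtTh] §1 interface (not the tempered `π₁` of a curve); the [IUTchII]
claim key `Mochizuki2012` is DISPUTED (D-0012) and nothing of it is asserted; nothing of [EtTh] is asserted beyond the tree's
proofs; no side is taken on [IUTchIII] Cor. 3.12; typed ≠ proved; re-closed-at-a-model ≠ proved-as-printed; nothing here says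
abc is proved or refuted.
-/
noncomputable section

namespace Literature.IUT.HodgeArakelov

open Literature.AnabelianGeometry.EtaleTheta Literature.AnabelianGeometry.EtaleTheta.SettingModel
open Literature.AnabelianGeometry.SemiGraphs
open scoped Literature.AnabelianGeometry.EtaleTheta

/-! ## Node `IUTchII:Prop1.5(i)` — Prop. 1.5 (i)′ with the F-0638 fibre clause supplied at the models -/

namespace EtaleLevels

section ModelChiQ

variable (p : ℕ) [Fact p.Prime] (i j : ℤ) (hj : Even j)
  {E : (Literature.AnabelianGeometry.EtaleTheta.ThetaSetting.modelχq p i j hj).EtaleThetaData} {l : ℕ}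
  (C : E.DoubleUnderline l)
  (hC : (ThetaSetting.modelχq p i j hj).Compat) (hS : (ThetaSetting.modelχq p i j hj).Sec2Hyps)
  (hl : l.Prime) (hp2 : p ≠ 2) (hpl : p ≠ l)
  (hζ : ∃ ζ : (ThetaSetting.modelχq p i j hj).K, IsPrimitiveRoot ζ (4 * l))
  {Es : Set ℕ+} (τ : (ThetaSetting.modelχq p i j hj).CyclotomeTower l Es)
  (f : contCocycles (ThetaSetting.modelχq p i j hj).toTheta (ThetaSetting.modelχq p i j hj).DeltaTheta C.GtpYdduu)
  (hf : f ∈ C.rootCocycles hC)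

/-- **IUTchII:Prop1.5(i)′ over `ℕ≥1` AT THE STAGE-2 MODEL `modelχq p i j`, modulo {[EtTh] Prop. 1.5 (iii), the cusp
labels, the F-0639 level instances} — the F-0638 fibre clause DISCHARGED**: abc-iut-L2-t10's `prop15_i'_of_cyclotomeTower`
with `hslimX := isSlimGroup_PiTpχq`, `haugOpen := isOpenMap_aug_modelχq` (abc-iut-L2-t5) and
`hfibre M := thetaEnvData_cor218_iv_fibre_of_origin (τ.modAll M) … modelχq_isEtThOrigin hYcl_modelχq` (abc-iut-f-150 /
abc-iut-L2-t8).  For every étale-theta datum `E` over the model, every `X̲̲`-choice, every compatible cyclotome tower `τ` and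
root cocycle `f`, any two compatible projective systems over the model family are compatibly isomorphic.
[claim: Mochizuki2012, status: disputed] (IUTchII §1 Prop 1.5 (i), kurims p.29) [cite: MochizukiEtTh2009, Cor 2.18 (iv) p.61] -/
theorem prop15_i'_of_cyclotomeTower_modelχq_of_cor218_iv_surjective
    (h15 : Literature.AnabelianGeometry.EtaleTheta.ThetaSetting.Prop15iii E hC) (L : C.CuspLabels)
    (hsurj : ∀ M : ℕ+, (C.thetaEnvData (τ.modAll M) hC hS).Cor218_iv_surjective)
    (A B : MonoThetaProjSystem (modelFamily C hC hS hl hp2 hpl hζ τ.modAll f hf)) :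
    Literature.IUT.HodgeArakelov.Prop15_i'
      (reductions C hC hS hl hp2 hpl hζ τ.modAll f hf τ.red_modAll (isSlimGroup_PiTpχq p i j)) A B :=
  prop15_i'_of_cyclotomeTower C hC hS hl hp2 hpl hζ τ f hf (isSlimGroup_PiTpχq p i j)
    (isOpenMap_aug_modelχq p i j hj) hsurj
    (fun M => C.thetaEnvData_cor218_iv_fibre_of_origin (τ.modAll M) hC hS h15 L
      (ThetaSetting.modelχq_isEtThOrigin p i j hj) (hYcl_modelχq p i j hj)) A B

/-- **The same over a compatible cyclotome FAMILY `mods`** (the currency of abc-iut-w4-d030's `prop15_i'_etaleLevels`,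
`levelData C hC hS mods M = C.thetaEnvData (mods M) hC hS`): Prop. 1.5 (i)′ at `modelχq p i j` modulo {`h15`, `L`, the
F-0639 level instances}, the F-0638 fibre clause DISCHARGED.
[claim: Mochizuki2012, status: disputed] (IUTchII §1 Prop 1.5 (i), kurims p.29) [cite: MochizukiEtTh2009, Cor 2.18 (iv) p.61] -/
theorem prop15_i'_etaleLevels_modelχq_of_cor218_iv_surjective
    (mods : ∀ M : ℕ+, (ThetaSetting.modelχq p i j hj).CyclotomeMod l M)
    (hmods : ∀ (M M' : ℕ+) (h : (M : ℕ) ∣ (M' : ℕ)) (x : (ThetaSetting.modelχq p i j hj).lDeltaTheta l),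
      MuN.red p M M' h ((mods M').red x) = (mods M).red x)
    (h15 : Literature.AnabelianGeometry.EtaleTheta.ThetaSetting.Prop15iii E hC) (L : C.CuspLabels)
    (hsurj : ∀ M : ℕ+, (levelData C hC hS mods M).Cor218_iv_surjective)
    (A B : MonoThetaProjSystem (modelFamily C hC hS hl hp2 hpl hζ mods f hf)) :
    Literature.IUT.HodgeArakelov.Prop15_i'
      (reductions C hC hS hl hp2 hpl hζ mods f hf hmods (isSlimGroup_PiTpχq p i j)) A B :=
  prop15_i'_etaleLevels C hC hS hl hp2 hpl hζ mods f hf hmods (isSlimGroup_PiTpχq p i j)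
    (isOpenMap_aug_modelχq p i j hj) hsurj
    (fun M => C.thetaEnvData_cor218_iv_fibre_of_origin (mods M) hC hS h15 L
      (ThetaSetting.modelχq_isEtThOrigin p i j hj) (hYcl_modelχq p i j hj)) A B

end ModelChiQ

section ModelTateInr

variable (p : ℕ) [Fact p.Prime] {l : ℕ} (C : (etaleThetaDataχqInr p).DoubleUnderline l)
  (hC : (ThetaSetting.modelχq p 1 2 even_two).Compat) (hS : (ThetaSetting.modelχq p 1 2 even_two).Sec2Hyps)
  (hl : l.Prime) (hp2 : p ≠ 2) (hpl : p ≠ l)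
  (hζ : ∃ ζ : (ThetaSetting.modelχq p 1 2 even_two).K, IsPrimitiveRoot ζ (4 * l))
  {Es : Set ℕ+} (τ : (ThetaSetting.modelχq p 1 2 even_two).CyclotomeTower l Es)
  (f : contCocycles (ThetaSetting.modelχq p 1 2 even_two).toTheta (ThetaSetting.modelχq p 1 2 even_two).DeltaTheta
    C.GtpYdduu)
  (hf : f ∈ C.rootCocycles hC)

/-- **IUTchII:Prop1.5(i)′ at the `inr`-section étale-theta datum OF RECORD of the Tate instance, modulo the cusp labels
and the F-0639 level instances ONLY** — [EtTh] Prop. 1.5 (iii) now abc-iut-L2-t6's THEOREM `prop15iii_etaleThetaDataχqInr`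
(over abc-iut-w5-d171's `etaleThetaDataχqInr`); the alternative residual to {Cor. 2.18 (i) at the chain levels,
`ThetaEnvTower.Cor219_iii`} of abc-iut-w4-d038's `prop15_i'_of_cyclotomeTower_modelTate`.
[claim: Mochizuki2012, status: disputed] (IUTchII §1 Prop 1.5 (i), kurims p.29) [cite: MochizukiEtTh2009, Cor 2.18 (iv) p.61] -/
theorem prop15_i'_of_cyclotomeTower_modelTate_inr_of_cor218_iv_surjective (L : C.CuspLabels)
    (hsurj : ∀ M : ℕ+, (C.thetaEnvData (τ.modAll M) hC hS).Cor218_iv_surjective)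
    (A B : MonoThetaProjSystem (modelFamily C hC hS hl hp2 hpl hζ τ.modAll f hf)) :
    Literature.IUT.HodgeArakelov.Prop15_i'
      (reductions C hC hS hl hp2 hpl hζ τ.modAll f hf τ.red_modAll (isSlimGroup_PiTpχq p 1 2)) A B :=
  prop15_i'_of_cyclotomeTower_modelχq_of_cor218_iv_surjective p 1 2 even_two C hC hS hl hp2 hpl hζ τ f hf
    (prop15iii_etaleThetaDataχqInr p hC) L hsurj A B

/-- **Family form at the `inr`-section datum OF RECORD of the Tate instance** (currency of `prop15_i'_etaleLevels`):
Prop. 1.5 (i)′ modulo the cusp labels and the F-0639 level instances ONLY.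
[claim: Mochizuki2012, status: disputed] (IUTchII §1 Prop 1.5 (i), kurims p.29) [cite: MochizukiEtTh2009, Cor 2.18 (iv) p.61] -/
theorem prop15_i'_etaleLevels_modelTate_inr_of_cor218_iv_surjective
    (mods : ∀ M : ℕ+, (ThetaSetting.modelχq p 1 2 even_two).CyclotomeMod l M)
    (hmods : ∀ (M M' : ℕ+) (h : (M : ℕ) ∣ (M' : ℕ)) (x : (ThetaSetting.modelχq p 1 2 even_two).lDeltaTheta l),
      MuN.red p M M' h ((mods M').red x) = (mods M).red x)
    (L : C.CuspLabels) (hsurj : ∀ M : ℕ+, (levelData C hC hS mods M).Cor218_iv_surjective)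
    (A B : MonoThetaProjSystem (modelFamily C hC hS hl hp2 hpl hζ mods f hf)) :
    Literature.IUT.HodgeArakelov.Prop15_i'
      (reductions C hC hS hl hp2 hpl hζ mods f hf hmods (isSlimGroup_PiTpχq p 1 2)) A B :=
  prop15_i'_etaleLevels_modelχq_of_cor218_iv_surjective p 1 2 even_two C hC hS hl hp2 hpl hζ f hf mods hmods
    (prop15iii_etaleThetaDataχqInr p hC) L hsurj A B

end ModelTateInr

end EtaleLevels

end Literature.IUT.HodgeArakelov

end
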